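import Summits.Ventures.HSemireg.WedgeHankelFrameChange

/-!
# Venture HSemireg — THE HANKEL RANK OF A DIVISOR CLASS `Σ_i exp(λ_i Θ)·p_i(Θ)` (`deg p_i = P_i`, distinct `λ_i`):
# `rank H_k = Σ_i (P_i + 1)` whenever `Σ_i (P_i + 1) ≤ min(k + 1, n + 1 − k)` — confluent exponential sequences are independent

HONEST FRAMING. Part of the Lean index of the computation cell `pub-hsemireg` (seat p10 gen 16, Sunday typer «UNIFORM-IN-n»).
LINEAR ALGEBRA OF HANKEL (catalecticant) MATRICES over a field ONLY: no variety, no cohomology theory, no sheaf, no Ext group, no semiregularity map;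
nothing here says that HC / HC_CM / HC_AV holds; no Literature fact is declared or used.  Custodian versions as in `WedgeHankelSiegelIdeal` (1/3) and
`WedgeHankelFrameChange`; the dictionary (`exp(λΘ)·Σ_{t≤P} q_t Θ^t/t!` ↦ the binomial transform `expMul λ q`, `q` supported on `[0, P]`; the DIVISOR
`Σ_i (P_i + 1)[λ_i]` of the class) is QUOTED, never asserted.

WHAT IS IN THE TREE.  Gen 14 D1 `WedgeHankelSecantRank`: SIMPLE nodes — `rank H_k(Σ_i A_i λ_i^•) = min(r, k+1)` by a Vandermonde minor; gen 15 E6/E10: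
ONE node of any order (`rank_hankel1_of_order`, `…_expMul_of_order`) and TWO nodes (`rank_hankel1_of_two_orders`) READ OFF the kernel laws.  THIS FILE does
`r` nodes WITH MULTIPLICITIES by linear algebra in th-7's sequence vocabulary (no determinant, no polynomial ring, every field):
* §50 **INDEPENDENCE `expMul_sum_eq_zero`**: if `Σ_i expMul λ_i q_i` vanishes on the window `[0, D)` where the `λ_i` are distinct, `q_i` is supported on
  `[0, m_i)` and `D = Σ_i m_i`, then every `q_i = 0` — induction on `D`: the operator `σ − λ_{i₀}` keeps every node and lowers the order at `i₀` by one
  (`expMul_shear_seq`: `expMul λ ((λ−λ₀)q + σq) = σ(expMul λ q) − λ₀·expMul λ q`).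
* §51 the CONFLUENT NODE MATRIX `cvMat λ P c` (rows `(i, t)`, `t ≤ P_i`; columns `l < c`; entries `C(l,t) λ_i^{l−t}`) and the block-diagonal HANKEL-OF-COEFFICIENTS
  matrix `hkMat q` (`(i,t),(i,t′) ↦ q_i(t+t′)`); **`hankel1_expMul_sum`: `H_k(Σ_i expMul λ_i q_i) = (cvMat (k+1))ᵀ · hkMat q · cvMat (n+1−k)`** (the binomial
  theorem for `(λ + σ)^a`, `expMul_apply_add`); hence `rank H_k ≤ Σ_i (P_i+1)` always (`rank_hankel1_expMul_sum_le`).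
* §52 the three factors: `(cvMat c)ᵀ` is injective for `D ≤ c` (§50), so `cvMat c` is onto `K^D`; `hkMat q` is invertible when every `q_i` has EXACT order `P_i`
  (anti-triangular blocks, `hkMat_mulVec_injective`); **THE DIVISOR RANK LAW `rank_hankel1_expMul_sum`: `rank H_k(Σ_i expMul λ_i q_i) = Σ_i (P_i + 1)`
  for distinct `λ_i`, `q_i` supported on `[0, P_i]` with `q_i(P_i) ≠ 0`, and `Σ_i (P_i+1) ≤ k + 1`, `≤ n + 1 − k`** — each node contributes its order.
NOT typed here: the full-row-rank regime `Σ_i (P_i+1) ≥ k + 1` (rank `k + 1`; a sub-divisor of total order `k + 1` would do it); the node at `∞` together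
with finite nodes (E9/E10 do one finite node + `∞`); the kernel NAME for a divisor (next leaf: the intersection of the one-node kernels, by codimension).
Namespace `Summit.Ventures.HSemireg.Wedge.HankelFrameChange` (continued; `expMul` lives there); new names only.
-/

open Module
open scoped Matrix

namespace Summit.Ventures.HSemireg.Wedge.HankelFrameChange

open Summit.Ventures.HSemireg.Wedge Summit.Ventures.HSemireg.Wedge.Hankel

variable (K : Type*) [Field K]

/-! ## §50. Independence of confluent exponential sequences -/

/-- **`expMul λ ((λ − λ₀)·q + σq) = σ(expMul λ q) − λ₀ · expMul λ q`** pointwise: the operator `σ − λ₀` acts on a node-`λ` class by `q ↦ (λ−λ₀)q + σq`. -/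
theorem expMul_shear_seq (lam lam₀ : K) (q : ℕ → K) (j : ℕ) :
    expMul K lam (fun i => (lam - lam₀) * q i + q (i + 1)) j = expMul K lam q (j + 1) - lam₀ * expMul K lam q j := by
  have e : (fun i => (lam - lam₀) * q i + q (i + 1)) = fun i => (lam - lam₀) * q i + shift K q i := rfl
  rw [e, expMul_add, expMul_smul, expMul_succ]; ring

/-- back-substitution: if `(λ − λ₀) q_j + q_{j+1} = 0` for all `j`, `λ ≠ λ₀`, and `q` vanishes beyond some point, then `q = 0`. -/
lemma seq_eq_zero_of_shear_eq_zero {lam lam₀ : K} (hne : lam ≠ lam₀) {m : ℕ} {q : ℕ → K} (hq : ∀ j, m ≤ j → q j = 0)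
    (h : ∀ j, (lam - lam₀) * q j + q (j + 1) = 0) : ∀ j, q j = 0 := by
  have key : ∀ d j, m ≤ j + d → q j = 0 := by
    intro d
    induction d with
    | zero => intro j hj; exact hq j (by omega)
    | succ d ih =>
      intro j hj
      have h1 : q (j + 1) = 0 := ih (j + 1) (by omega)
      have h2 := h j
      rw [h1, add_zero] at h2
      exact (mul_eq_zero.mp h2).resolve_left (sub_ne_zero.mpr hne)
  exact fun j => key m j (by omega)

/-- **INDEPENDENCE OF CONFLUENT EXPONENTIAL SEQUENCES**: distinct nodes `λ_i`, coefficient sequences `q_i` supported on `[0, m_i)`, `D = Σ_i m_i`; if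
`Σ_i expMul λ_i q_i` vanishes on the window `[0, D)` then every `q_i` is zero (Hermite-interpolation uniqueness, every field; induction on `D` with the
operator `σ − λ_{i₀}`). -/
theorem expMul_sum_eq_zero {r : ℕ} {lam : Fin r → K} (hlam : Function.Injective lam) :
    ∀ (D : ℕ) (m : Fin r → ℕ) (q : Fin r → ℕ → K), ∑ i, m i = D → (∀ i j, m i ≤ j → q i j = 0) →
      (∀ j, j < D → ∑ i, expMul K (lam i) (q i) j = 0) → ∀ i j, q i j = 0 := by
  intro D
  induction D with
  | zero =>
    intro m q hD hq _ i j
    have hm : m i = 0 := (Finset.sum_eq_zero_iff.mp hD) i (Finset.mem_univ i)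
    exact hq i j (by omega)
  | succ D ih =>
    intro m q hD hq h0
    -- a node of positive order
    obtain ⟨i₀, hi₀⟩ : ∃ i₀, 0 < m i₀ := by
      by_contra hcon
      have : ∑ i, m i = 0 := Finset.sum_eq_zero fun i _ => Nat.le_zero.mp (not_lt.mp (fun h => hcon ⟨i, h⟩))
      omega
    -- apply σ − λ_{i₀}
    set q' : Fin r → ℕ → K := fun i j => (lam i - lam i₀) * q i j + q i (j + 1) with hq'
    set m' : Fin r → ℕ := Function.update m i₀ (m i₀ - 1) with hm'
    have hD' : ∑ i, m' i = D := by
      have h1 : ∑ i, m' i = (m i₀ - 1) + ∑ x ∈ Finset.univ.erase i₀, m x := by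
        rw [hm', Finset.sum_update_of_mem (Finset.mem_univ i₀), Finset.sdiff_singleton_eq_erase]
      have h2 : m i₀ + ∑ x ∈ Finset.univ.erase i₀, m x = ∑ i, m i := Finset.add_sum_erase _ _ (Finset.mem_univ i₀)
      omega
    have hq'supp : ∀ i j, m' i ≤ j → q' i j = 0 := by
      intro i j hj
      simp only [hq']
      by_cases hi : i = i₀
      · subst hi
        rw [hm', Function.update_self] at hj
        rw [sub_self, zero_mul, zero_add, hq _ _ (by omega)]
      · rw [hm', Function.update_of_ne hi] at hj
        rw [hq _ _ hj, hq _ _ (by omega), mul_zero, add_zero]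
    have h0' : ∀ j, j < D → ∑ i, expMul K (lam i) (q' i) j = 0 := by
      intro j hj
      have e : ∑ i, expMul K (lam i) (q' i) j = ∑ i, expMul K (lam i) (q i) (j + 1) - lam i₀ * ∑ i, expMul K (lam i) (q i) j := by
        rw [Finset.mul_sum, ← Finset.sum_sub_distrib]
        exact Finset.sum_congr rfl fun i _ => expMul_shear_seq K _ _ _ _
      rw [e, h0 _ (by omega), h0 _ (by omega), mul_zero, sub_zero]
    have hz := ih m' q' hD' hq'supp h0'
    -- back-substitute
    have hoth : ∀ i, i ≠ i₀ → ∀ j, q i j = 0 := fun i hi =>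
      seq_eq_zero_of_shear_eq_zero K (fun e => hi (hlam e)) (hq i) (fun j => hz i j)
    have hi₀succ : ∀ j, q i₀ (j + 1) = 0 := fun j => by
      have := hz i₀ j; simp only [hq', sub_self, zero_mul, zero_add] at this; exact this
    have hi₀zero : q i₀ 0 = 0 := by
      have h00 := h0 0 (by omega)
      rw [Finset.sum_eq_single i₀ (fun i _ hi => by rw [expMul_zero, hoth i hi]) (fun h => absurd (Finset.mem_univ i₀) h),
        expMul_zero] at h00
      exact h00
    intro i j
    by_cases hi : i = i₀
    · subst hi; cases j with
      | zero => exact hi₀zero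
      | succ j => exact hi₀succ j
    · exact hoth i hi j

/-! ## §51. The binomial theorem for `σ^a` on a node-`λ` class and the factorization of the Hankel matrix -/

/-- **`(expMul λ q)_{a+s} = (expMul λ (R_a q))_s` with `(R_a q)_i = (expMul λ (t ↦ q_{i+t}))_a`** — `σ^a ∘ expMul λ = expMul λ ∘ (λ + σ)^a`, by th-7's
recursion only (no Pascal identity). -/
theorem expMul_apply_add (lam : K) : ∀ (a : ℕ) (q : ℕ → K) (s : ℕ),
    expMul K lam q (a + s) = expMul K lam (fun i => expMul K lam (fun t => q (i + t)) a) s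
  | 0, q, s => by rw [Nat.zero_add]; rfl
  | a + 1, q, s => by
    rw [show a + 1 + s = (a + s) + 1 by omega, expMul_succ, expMul_apply_add lam a q s, expMul_apply_add lam a (shift K q) s,
      ← expMul_smul, ← expMul_add]
    rfl

/-- hence the symmetric double sum **`(expMul λ q)_{a+s} = Σ_{t′ ≤ s} C(s,t′) λ^{s−t′} Σ_{t ≤ a} C(a,t) λ^{a−t} q_{t′+t}`.** -/
theorem expMul_apply_add_eq_sum (lam : K) (q : ℕ → K) (a s : ℕ) :
    expMul K lam q (a + s) = ∑ t' ∈ Finset.range (s + 1), (s.choose t' : K) * lam ^ (s - t') *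
      ∑ t ∈ Finset.range (a + 1), (a.choose t : K) * lam ^ (a - t) * q (t' + t) := by
  rw [expMul_apply_add, expMul_eq_sum]
  refine Finset.sum_congr rfl fun t' _ => ?_
  rw [expMul_eq_sum]

/-- a range sum may be re-cut wherever the summand vanishes beyond the shorter range. -/
private lemma sum_range_recut {A B : ℕ} {f : ℕ → K} (hf : ∀ t, min A B ≤ t → f t = 0) :
    ∑ t ∈ Finset.range A, f t = ∑ t ∈ Finset.range B, f t := by
  have key : ∀ {C D : ℕ}, C ≤ D → (∀ t, C ≤ t → f t = 0) → ∑ t ∈ Finset.range C, f t = ∑ t ∈ Finset.range D, f t :=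
    fun hCD h => Finset.sum_subset (Finset.range_mono hCD) fun t _ ht => h t (by rw [Finset.mem_range] at ht; omega)
  rcases le_total A B with h | h
  · exact key h fun t ht => hf t (by rw [min_eq_left h]; exact ht)
  · exact (key h fun t ht => hf t (by rw [min_eq_right h]; exact ht)).symm

/-- the binomial window of a sequence supported on `[0, P]`, as a sum over `Fin (P+1)`:
`Σ_{t ≤ a} C(a,t) λ^{a−t} q_{t′+t} = Σ_{t : Fin (P+1)} C(a,t) λ^{a−t} q_{t+t′}`. -/
lemma binomWindow_eq_sum_fin (lam : K) {P : ℕ} {q : ℕ → K} (hq : ∀ j, P < j → q j = 0) (a t' : ℕ) :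
    ∑ t ∈ Finset.range (a + 1), (a.choose t : K) * lam ^ (a - t) * q (t' + t) =
      ∑ t : Fin (P + 1), ((a.choose (t : ℕ) : K) * lam ^ (a - (t : ℕ)) * q ((t : ℕ) + t')) := by
  rw [← Finset.sum_range (fun t => (a.choose t : K) * lam ^ (a - t) * q (t + t'))]
  have e : ∀ t, (a.choose t : K) * lam ^ (a - t) * q (t' + t) = (a.choose t : K) * lam ^ (a - t) * q (t + t') := fun t => by rw [add_comm t' t]
  rw [Finset.sum_congr rfl fun t _ => e t]
  refine sum_range_recut K fun t ht => ?_
  rcases lt_or_ge a t with h | h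
  · rw [Nat.choose_eq_zero_of_lt h, Nat.cast_zero, zero_mul, zero_mul]
  · rw [hq _ (by omega), mul_zero]

/-- **ONE NODE, ONE ENTRY**: for `q` supported on `[0, P]`,
`(expMul λ q)_{a+s} = Σ_{t′ : Fin (P+1)} (Σ_{t : Fin (P+1)} C(a,t) λ^{a−t} q_{t+t′}) · C(s,t′) λ^{s−t′}` — the `(a, s)` entry of `Cᵀ · H(q) · C`. -/
theorem expMul_apply_add_eq_sum_fin (lam : K) {P : ℕ} {q : ℕ → K} (hq : ∀ j, P < j → q j = 0) (a s : ℕ) :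
    expMul K lam q (a + s) = ∑ t' : Fin (P + 1), (∑ t : Fin (P + 1), ((a.choose (t : ℕ) : K) * lam ^ (a - (t : ℕ)) * q ((t : ℕ) + (t' : ℕ)))) *
      (((s.choose (t' : ℕ) : K)) * lam ^ (s - (t' : ℕ))) := by
  rw [expMul_apply_add_eq_sum]
  have e : ∀ t', (s.choose t' : K) * lam ^ (s - t') * ∑ t ∈ Finset.range (a + 1), (a.choose t : K) * lam ^ (a - t) * q (t' + t) =
      (∑ t : Fin (P + 1), ((a.choose (t : ℕ) : K) * lam ^ (a - (t : ℕ)) * q ((t : ℕ) + t'))) * ((s.choose t' : K) * lam ^ (s - t')) :=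
    fun t' => by rw [binomWindow_eq_sum_fin K lam hq, mul_comm]
  rw [Finset.sum_congr rfl fun t' _ => e t',
    ← Finset.sum_range (fun t' => (∑ t : Fin (P + 1), ((a.choose (t : ℕ) : K) * lam ^ (a - (t : ℕ)) * q ((t : ℕ) + t'))) *
      ((s.choose t' : K) * lam ^ (s - t')))]
  refine sum_range_recut K fun t' ht' => ?_
  rcases lt_or_ge s t' with h | h
  · rw [Nat.choose_eq_zero_of_lt h, Nat.cast_zero, zero_mul, mul_zero]
  · rw [Finset.sum_eq_zero fun t _ => by rw [hq _ (by omega), mul_zero], zero_mul]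

/-- the index type of the divisor `Σ_i (P_i + 1)[λ_i]`: pairs `(i, t)` with `t ≤ P_i`. -/
abbrev DIdx {r : ℕ} (P : Fin r → ℕ) : Type := (i : Fin r) × Fin (P i + 1)

/-- `|DIdx P| = Σ_i (P_i + 1)`, the total order of the divisor. -/
lemma card_DIdx {r : ℕ} (P : Fin r → ℕ) : Fintype.card (DIdx P) = ∑ i, (P i + 1) := by
  rw [Fintype.card_sigma]; simp only [Fintype.card_fin]

/-- **THE CONFLUENT NODE MATRIX** `cvMat λ P c`: rows `(i, t)` (`t ≤ P_i`), columns `l < c`, entries `C(l,t) λ_i^{l−t}`. -/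
def cvMat {r : ℕ} (lam : Fin r → K) (P : Fin r → ℕ) (c : ℕ) : Matrix (DIdx P) (Fin c) K :=
  Matrix.of fun x l => ((l : ℕ).choose (x.2 : ℕ) : K) * lam x.1 ^ ((l : ℕ) - (x.2 : ℕ))

/-- **THE HANKEL-OF-COEFFICIENTS MATRIX** (block diagonal): `((i,t),(i′,t′)) ↦ [i = i′] · q_i(t + t′)`. -/
def hkMat {r : ℕ} (P : Fin r → ℕ) (q : Fin r → ℕ → K) : Matrix (DIdx P) (DIdx P) K :=
  Matrix.of fun x y => if x.1 = y.1 then q x.1 ((x.2 : ℕ) + (y.2 : ℕ)) else 0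

/-- entries of `cvMat`. -/
lemma cvMat_apply {r : ℕ} (lam : Fin r → K) (P : Fin r → ℕ) (c : ℕ) (x : DIdx P) (l : Fin c) :
    cvMat K lam P c x l = ((l : ℕ).choose (x.2 : ℕ) : K) * lam x.1 ^ ((l : ℕ) - (x.2 : ℕ)) := rfl

/-- entries of `hkMat`. -/
lemma hkMat_apply {r : ℕ} (P : Fin r → ℕ) (q : Fin r → ℕ → K) (x y : DIdx P) :
    hkMat K P q x y = if x.1 = y.1 then q x.1 ((x.2 : ℕ) + (y.2 : ℕ)) else 0 := rfl

/-- **THE FACTORIZATION `H_k(Σ_i expMul λ_i q_i) = (cvMat (k+1))ᵀ · hkMat q · cvMat (n+1−k)`** for `q_i` supported on `[0, P_i]`. -/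
theorem hankel1_expMul_sum (n k : ℕ) {r : ℕ} (lam : Fin r → K) {P : Fin r → ℕ} {q : Fin r → ℕ → K}
    (hq : ∀ i j, P i < j → q i j = 0) :
    hankel1 K n k (fun j => ∑ i, expMul K (lam i) (q i) j) = (cvMat K lam P (k + 1))ᵀ * hkMat K P q * cvMat K lam P (n + 1 - k) := by
  ext a s
  rw [hankel1, Matrix.of_apply, Matrix.mul_apply]
  simp only [Matrix.mul_apply, Matrix.transpose_apply, cvMat_apply, hkMat_apply]
  -- right side: collapse the block-diagonal double sum over the divisor index
  have hR : ∀ y : DIdx P, (∑ x : DIdx P, ((a : ℕ).choose (x.2 : ℕ) : K) * lam x.1 ^ ((a : ℕ) - (x.2 : ℕ)) *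
      (if x.1 = y.1 then q x.1 ((x.2 : ℕ) + (y.2 : ℕ)) else 0)) =
      ∑ t : Fin (P y.1 + 1), ((a : ℕ).choose (t : ℕ) : K) * lam y.1 ^ ((a : ℕ) - (t : ℕ)) * q y.1 ((t : ℕ) + (y.2 : ℕ)) := by
    intro y
    rw [Fintype.sum_sigma]
    have e : ∀ i : Fin r, (∑ t : Fin (P i + 1), ((a : ℕ).choose (t : ℕ) : K) * lam i ^ ((a : ℕ) - (t : ℕ)) *
        (if i = y.1 then q i ((t : ℕ) + (y.2 : ℕ)) else 0)) =
        if i = y.1 then ∑ t : Fin (P i + 1), ((a : ℕ).choose (t : ℕ) : K) * lam i ^ ((a : ℕ) - (t : ℕ)) * q i ((t : ℕ) + (y.2 : ℕ)) else 0 := by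
      intro i
      split_ifs with h
      · rfl
      · exact Finset.sum_eq_zero fun t _ => by rw [mul_zero]
    rw [Fintype.sum_congr _ _ e, Fintype.sum_ite_eq']
  simp_rw [hR]
  rw [Fintype.sum_sigma]
  exact Finset.sum_congr rfl fun i _ => expMul_apply_add_eq_sum_fin K (lam i) (hq i) a s

/-- hence **`rank H_k(Σ_i expMul λ_i q_i) ≤ Σ_i (P_i + 1)`** for every `k` and all nodes (the middle factor has that size). -/
theorem rank_hankel1_expMul_sum_le (n k : ℕ) {r : ℕ} (lam : Fin r → K) {P : Fin r → ℕ} {q : Fin r → ℕ → K}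
    (hq : ∀ i j, P i < j → q i j = 0) : (hankel1 K n k (fun j => ∑ i, expMul K (lam i) (q i) j)).rank ≤ ∑ i, (P i + 1) := by
  rw [hankel1_expMul_sum K n k lam hq, ← card_DIdx P]
  exact (Matrix.rank_mul_le_left _ _).trans ((Matrix.rank_mul_le_right _ _).trans (Matrix.rank_le_card_width _))

/-! ## §52. The three factors and the divisor rank law -/

/-- the zero-extension to `ℕ` of the `i`-th block of a vector indexed by the divisor. -/
def extSeq {r : ℕ} {P : Fin r → ℕ} (w : DIdx P → K) (i : Fin r) : ℕ → K := fun t => if h : t < P i + 1 then w ⟨i, ⟨t, h⟩⟩ else 0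

/-- `extSeq w i` vanishes beyond `P_i`. -/
lemma extSeq_apply_of_lt {r : ℕ} {P : Fin r → ℕ} (w : DIdx P → K) (i : Fin r) {t : ℕ} (ht : P i < t) : extSeq K w i t = 0 := by
  rw [extSeq, dif_neg (by omega)]

/-- `extSeq w i` on the block. -/
lemma extSeq_apply_fin {r : ℕ} {P : Fin r → ℕ} (w : DIdx P → K) (i : Fin r) (t : Fin (P i + 1)) : extSeq K w i t = w ⟨i, t⟩ := by
  rw [extSeq, dif_pos t.2]

/-- **`(cvMat c)ᵀ w` is the divisor sequence `Σ_i expMul λ_i (extSeq w i)` on the window `[0, c)`.** -/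
lemma cvMat_transpose_mulVec {r : ℕ} (lam : Fin r → K) (P : Fin r → ℕ) (c : ℕ) (w : DIdx P → K) (l : Fin c) :
    ((cvMat K lam P c)ᵀ *ᵥ w) l = ∑ i, expMul K (lam i) (extSeq K w i) l := by
  rw [Matrix.mulVec, dotProduct, Fintype.sum_sigma]
  refine Finset.sum_congr rfl fun i _ => ?_
  simp only [Matrix.transpose_apply, cvMat_apply]
  rw [expMul_eq_sum, sum_range_recut K (A := (l : ℕ) + 1) (B := P i + 1), Finset.sum_range]
  · exact Finset.sum_congr rfl fun t _ => by rw [extSeq_apply_fin]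
  · intro t ht
    rcases lt_or_ge (l : ℕ) t with h | h
    · rw [Nat.choose_eq_zero_of_lt h, Nat.cast_zero, zero_mul, zero_mul]
    · rw [extSeq_apply_of_lt K w i (show P i < t by omega), mul_zero]

/-- **`(cvMat c)ᵀ` IS INJECTIVE for `Σ_i (P_i+1) ≤ c`** (§50). -/
theorem cvMat_transpose_mulVecLin_injective {r : ℕ} {lam : Fin r → K} (hlam : Function.Injective lam) (P : Fin r → ℕ) {c : ℕ}
    (hc : ∑ i, (P i + 1) ≤ c) : Function.Injective (cvMat K lam P c)ᵀ.mulVecLin := by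
  rw [← LinearMap.ker_eq_bot, LinearMap.ker_eq_bot']
  intro w hw
  have h0 : ∀ j, j < ∑ i, (P i + 1) → ∑ i, expMul K (lam i) (extSeq K w i) j = 0 := fun j hj => by
    have := congrFun hw ⟨j, by omega⟩
    rwa [Matrix.mulVecLin_apply, cvMat_transpose_mulVec] at this
  have hz := expMul_sum_eq_zero K hlam _ (fun i => P i + 1) (extSeq K w) rfl
    (fun i j hj => extSeq_apply_of_lt K w i (by omega)) h0
  funext x
  obtain ⟨i, t⟩ := x
  rw [← extSeq_apply_fin K w i t, hz, Pi.zero_apply]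

/-- so `cvMat c` has rank `Σ_i (P_i + 1)` … -/
theorem rank_cvMat {r : ℕ} {lam : Fin r → K} (hlam : Function.Injective lam) (P : Fin r → ℕ) {c : ℕ} (hc : ∑ i, (P i + 1) ≤ c) :
    (cvMat K lam P c).rank = ∑ i, (P i + 1) := by
  rw [← Matrix.rank_transpose, Matrix.rank, LinearMap.finrank_range_of_inj (cvMat_transpose_mulVecLin_injective K hlam P hc),
    finrank_fintype_fun_eq_card, card_DIdx]

/-- … and is onto `K^{Σ(P_i+1)}` (Hermite interpolation is solvable). -/
theorem range_cvMat_mulVecLin_eq_top {r : ℕ} {lam : Fin r → K} (hlam : Function.Injective lam) (P : Fin r → ℕ) {c : ℕ}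
    (hc : ∑ i, (P i + 1) ≤ c) : LinearMap.range (cvMat K lam P c).mulVecLin = ⊤ := by
  apply Submodule.eq_top_of_finrank_eq
  rw [← Matrix.rank, rank_cvMat K hlam P hc, finrank_fintype_fun_eq_card, card_DIdx]

/-- the rows of `hkMat q · v`: `(hkMat q v)_{(i,t)} = Σ_{t′ ≤ P_i} q_i(t + t′) v_{(i,t′)}`. -/
lemma hkMat_mulVec {r : ℕ} (P : Fin r → ℕ) (q : Fin r → ℕ → K) (v : DIdx P → K) (i : Fin r) (t : Fin (P i + 1)) :
    (hkMat K P q *ᵥ v) ⟨i, t⟩ = ∑ t' : Fin (P i + 1), q i ((t : ℕ) + (t' : ℕ)) * v ⟨i, t'⟩ := by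
  rw [Matrix.mulVec, dotProduct, Fintype.sum_sigma]
  simp only [hkMat_apply]
  have e : ∀ i' : Fin r, (∑ t' : Fin (P i' + 1), (if i = i' then q i ((t : ℕ) + (t' : ℕ)) else 0) * v ⟨i', t'⟩) =
      if i = i' then ∑ t' : Fin (P i' + 1), q i ((t : ℕ) + (t' : ℕ)) * v ⟨i', t'⟩ else 0 := by
    intro i'
    split_ifs with h
    · rfl
    · exact Finset.sum_eq_zero fun t _ => by rw [zero_mul]
  rw [Fintype.sum_congr _ _ e, Fintype.sum_ite_eq]

/-- **`hkMat q` IS INJECTIVE when every `q_i` has exact order `P_i`** (anti-triangular blocks with `q_i(P_i) ≠ 0` on the anti-diagonal). -/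
theorem hkMat_mulVecLin_injective {r : ℕ} (P : Fin r → ℕ) {q : Fin r → ℕ → K} (hq : ∀ i j, P i < j → q i j = 0)
    (hqP : ∀ i, q i (P i) ≠ 0) : Function.Injective (hkMat K P q).mulVecLin := by
  rw [← LinearMap.ker_eq_bot, LinearMap.ker_eq_bot']
  intro v hv
  have hrow : ∀ (i : Fin r) (t : Fin (P i + 1)), ∑ t' : Fin (P i + 1), q i ((t : ℕ) + (t' : ℕ)) * v ⟨i, t'⟩ = 0 := fun i t => by
    have := congrFun hv ⟨i, t⟩
    rwa [Matrix.mulVecLin_apply, hkMat_mulVec] at this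
  have key : ∀ (i : Fin r) (d : ℕ) (hd : d < P i + 1), v ⟨i, ⟨d, hd⟩⟩ = 0 := by
    intro i d
    induction d using Nat.strong_induction_on with
    | _ d IH =>
      intro hd
      have h := hrow i ⟨P i - d, by omega⟩
      rw [Finset.sum_eq_single ⟨d, hd⟩] at h
      · rw [show ((⟨P i - d, by omega⟩ : Fin (P i + 1)) : ℕ) + ((⟨d, hd⟩ : Fin (P i + 1)) : ℕ) = P i by simp; omega] at h
        exact (mul_eq_zero.mp h).resolve_left (hqP i)
      · intro t' _ ht'
        by_cases hlt : (t' : ℕ) < d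
        · have h1 := IH t' hlt t'.2
          rw [Fin.eta] at h1
          rw [h1, mul_zero]
        · have hne : (t' : ℕ) ≠ d := fun e => ht' (Fin.ext e)
          rw [hq i _ (by simp; omega), zero_mul]
      · intro h; exact absurd (Finset.mem_univ _) h
  funext x
  obtain ⟨i, t⟩ := x
  have := key i t t.2
  rwa [Fin.eta] at this

/-- **THE DIVISOR RANK LAW: `rank H_k(Σ_i expMul λ_i q_i) = Σ_i (P_i + 1)`** for distinct nodes `λ_i`, `q_i` supported on `[0, P_i]` with `q_i(P_i) ≠ 0`,
and `Σ_i (P_i + 1) ≤ k + 1`, `Σ_i (P_i + 1) ≤ n + 1 − k` — the class `Σ_i exp(λ_i Θ)·p_i(Θ)` (`deg p_i = P_i`) has catalecticant rank the total order of its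
divisor (D1's `r` for simple nodes; E6's `P + 1` for one node; E10's `P + P′ + 2`, there with one node at `∞`). -/
theorem rank_hankel1_expMul_sum {n k r : ℕ} {lam : Fin r → K} (hlam : Function.Injective lam) {P : Fin r → ℕ} {q : Fin r → ℕ → K}
    (hq : ∀ i j, P i < j → q i j = 0) (hqP : ∀ i, q i (P i) ≠ 0) (hDk : ∑ i, (P i + 1) ≤ k + 1) (hDn : ∑ i, (P i + 1) ≤ n + 1 - k) :
    (hankel1 K n k (fun j => ∑ i, expMul K (lam i) (q i) j)).rank = ∑ i, (P i + 1) := by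
  have hinj : Function.Injective ((cvMat K lam P (k + 1))ᵀ.mulVecLin ∘ₗ (hkMat K P q).mulVecLin) := by
    rw [LinearMap.coe_comp]
    exact (cvMat_transpose_mulVecLin_injective K hlam P hDk).comp (hkMat_mulVecLin_injective K P hq hqP)
  rw [hankel1_expMul_sum K n k lam hq, Matrix.rank, Matrix.mulVecLin_mul,
    LinearMap.range_comp_of_range_eq_top _ (range_cvMat_mulVecLin_eq_top K hlam P hDn), Matrix.mulVecLin_mul,
    LinearMap.finrank_range_of_inj hinj, finrank_fintype_fun_eq_card, card_DIdx]

/-- **TWO FINITE NODES from the divisor law** (`Fin 2`): `rank H_k(expMul λ q₁ + expMul μ q₂) = P + P′ + 2` for `λ ≠ μ`, exact orders `P, P′`,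
`P + P′ + 2 ≤ k + 1` and `≤ n + 1 − k` — the value F1 reads off E10 by transport, here by linear algebra. -/
theorem rank_hankel1_expMul_add_expMul {n k : ℕ} {lam mu : K} (h : lam ≠ mu) {P P' : ℕ} {q₁ q₂ : ℕ → K}
    (hq₁ : ∀ j, P < j → q₁ j = 0) (hq₁P : q₁ P ≠ 0) (hq₂ : ∀ j, P' < j → q₂ j = 0) (hq₂P : q₂ P' ≠ 0)
    (hDk : P + P' + 2 ≤ k + 1) (hDn : P + P' + 2 ≤ n + 1 - k) :
    (hankel1 K n k (fun j => expMul K lam q₁ j + expMul K mu q₂ j)).rank = P + P' + 2 := by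
  have hlam : Function.Injective (![lam, mu] : Fin 2 → K) := by
    intro a b hab
    fin_cases a <;> fin_cases b
    · rfl
    · exact absurd hab h
    · exact absurd hab.symm h
    · rfl
  have e : (fun j => expMul K lam q₁ j + expMul K mu q₂ j) = fun j => ∑ i : Fin 2, expMul K (![lam, mu] i) (![q₁, q₂] i) j := by
    funext j; simp [Fin.sum_univ_two]
  have hsum : ∑ i : Fin 2, (![P, P'] i + 1) = P + P' + 2 := by simp [Fin.sum_univ_two]; ring
  rw [e, rank_hankel1_expMul_sum K hlam (P := ![P, P']) (fun i j hj => by fin_cases i <;> simp_all) (fun i => by fin_cases i <;> simp_all)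
      (by rw [hsum]; exact hDk) (by rw [hsum]; exact hDn), hsum]

end Summit.Ventures.HSemireg.Wedge.HankelFrameChange
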